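import Summits.QuantumFields.YangMills.Theorems.BalabanUVNodesN09TowerOfPerBondChartsOfWindowOpenness
import Summits.QuantumFields.YangMills.Theorems.BalabanUVNodesN09CentralWindowOpenMapping
import Summits.QuantumFields.YangMills.Theorems.BalabanUVNodesN09WindowInteriorAtRecord

/-!
# NODE N09 [B12] — ROAD A′ RUNS THE (F1) TOWER FROM FORWARD JACOBIAN LAWS AND NUMERICS: the two openness sentences (O-int), (O) of FILE 2 are the tree's theorems;
# `hreg_j` and (F3)_j for all `j < K` from the forward change-of-variables laws (densities bounded below on the window graph, continuous on the windows), the window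
# and margin numerics, [B11]-existence `hsolν`, N07's `hcrit`, (H-U) `hU` and (I19) `hint`

Cell `pub-ymgap` (YM-PLAN Track A), width seat `pub-ymgap-dag-n09-w5` g5 (D-0154 ∕ R399 (3a) width seat 5 of node N09), FILE 3; helper of K1⁹
`StabilityBRunRowsAtRecordR13SepCoPHV` = stmt-QuantumFields-27364 (`--supports`, `--as helper`, count-neutral).  [I] = [Balaban1987RG1] (CMP 109).

WHAT.  FILE 2 §2 `…N09TowerOfPerBondChartsOfWindowOpenness.hreg_pos_all_of_forwardLaws_of_openness` runs dag-n09-w1's (F1) regularity tower along road A′ from the FORWARD laws of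
the one-variable (0.4) averages plus two openness sentences: (O-int) «the image window is a neighbourhood of the image of every STRICT window point» and (O) «the image windows are
parametrically open at the critical configuration».  Both are now THEOREMS of numerics (+ [B11]-existence for (O)): (O-int) = dag-n09-w6 g4's
`…N09CentralWindowOpenMapping.imageWindow_record_mem_nhds_of_mem_strictCentralWindow` (inverse function theorem on dag-n09-w4 g5's jointly analytic chart model with the onto slice
derivative, pushed through the exponential chart; `α ≤ 1∕24`, `α < δ_N`, `157·α < L^{−(d−1)}`), (O) = dag-n09-w6 g4's `…N09WindowInteriorAtRecord.hopenCrit_of_hsolν_of_numerics` over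
dag-n09-w1 g6's `…N09OneBondParametricOpenness` (product-space inverse function theorem on the block-triangular joint map at the guarded critical configuration; `hsolν`, Prop-2
numerics, STRICT chart guard `(((d+2)L)²∕4)·(2ε_reg∕L²) < α`).  THIS FILE composes them in: ★★★ `hreg_pos_all_of_forwardLaws_of_hsolν_of_numerics`.

DISPLAYED (the located residue of road A′ after this file): the forward laws `hfwd` with densities `jac` — jointly measurable (`hjacm`), UNIFORMLY bounded below on the window
graph (`hjaclb`; = joint continuity + non-vanishing by FILE 2's `exists_pos_le_density_of_continuousOn_graph`) and continuous on each window (`hjacc`) — dag-n09-w4 g5's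
`exists_jacobian_forwardLaws_continuousOn` supplies `jac hjacm hjacc hfwd` (its `jac` behind an `∃`; the uniform lower bound ∕ joint continuity on the graph is the one letter
asked of that lane); the window numerics `0 ≤ α ≤ 1∕24`, `α < δ_N`, `157·α < L^{−(d−1)}`, `offCard c∕|Idx| + 150·α < 1`; the STRICT margin `(((d+2)L)²∕4)·ε₀ < α`; [B11] `hsolν`;
N07's `hcrit`; (H-U) `hU`; (I19) `hint` (itself `integrable_betaInput_stage13_of_measurableUk` at the record); dag-n09-w4 g3's numerics `hεreg hε3 hε2 hε29 hn1 hn2 hord`, `0 ≤ ε₀`,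
`((d·L)²∕4)·ε₀ < δ_Fed`.

WHAT IS PROVED (theorems only; 0 def, 0 instance, 0 notation, 0 sorry).  §1 `margin_two_εreg_lt_of_hord` (the STRICT `2ε_reg∕L²` chart guard from `hord` and the strict `ε₀`-margin) ·
★★★ `hreg_pos_all_of_forwardLaws_of_hsolν_of_numerics`; §2 at the Stage-13 record: ★★ `hreg_of_forwardLaws_of_hsolν_of_numerics` (the doors' `hreg`) · ★★★
`thm3Member_stage13SepCoPH_atDomAlt_of_forwardLaws_of_numerics_of_εreg_eq` (dag-n09-w4 g3's Theorem-3 door with `hreg` replaced by the forward-law package + numerics + N07∕[B11]∕(H-U)∕(I19)).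

HONEST FRAMING.  A COMPOSITION BY NAME (count-neutral); the forward laws and their densities with `hjaclb`∕`hjacc`, the numerics, `hcrit` ([B11] Thm 1 for a continuous selector),
`hsolν`, `hU`, `hint` stay DISPLAYED hypotheses, asserted of NO record; NO Jacobian law and NO density bound proved here; NOTHING of Bałaban's proved or denied; `hreg` RE-SHAPED
(now: forward Jacobian laws with a lower bound and fibrewise continuity of the density + numerics + N07 + [B11] + (H-U) + (I19)), NOT discharged; N09 NOT discharged; conjunct 1
(Lemma 4) and FLAG №7 untouched; K0⁷ ∕ K1⁹ ∕ K3⁸ NOT closed; counts unmoved (typed 28∕28 · discharged 5∕28); no summit statement is proved by this seat; one finite four-torus programme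
at fixed `ε = L^{−K}` per run — R4 closes the conditional rung `BalabanLadder.UV` only; NOT continuum ∕ ℝ⁴ ∕ infinite volume ∕ OS; the Yang–Mills mass gap (Clay) is NOT proved by
any of this.
-/

noncomputable section

namespace Summit.QuantumFields.YangMills.BalabanUVNodes.N09TowerOfForwardLawsOfNumerics

open MeasureTheory Set Function Filter Topology
open scoped ENNReal NNReal
open Literature.MathematicalPhysics.QuantumFieldTheory.Balaban1983to89
open Literature.MathematicalPhysics.QuantumFieldTheory.Balaban1983to89.T4Continuum (T4Family)
open Literature.MathematicalPhysics.QuantumFieldTheory.Balaban1983to89.Node00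
open Literature.MathematicalPhysics.QuantumFieldTheory.Balaban1983to89.ExpMeanLog (deltaSU)
open Literature.MathematicalPhysics.QuantumFieldTheory.Balaban1983to89.FederbushMean (deltaFed)
open Literature.MathematicalPhysics.QuantumFieldTheory.Balaban1983to89.BlockAveraging (Idx)
open Literature.MathematicalPhysics.QuantumFieldTheory.Balaban1983to89.BlockAveragingHaarAC (centralBond pre post)
open Literature.MathematicalPhysics.QuantumFieldTheory.Balaban1983to89.BlockAveragingEMLHaarAC (fibreFamily offCard)
open Literature.MathematicalPhysics.QuantumFieldTheory.Balaban1983to89.DagBinding (WorldP leavesP)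
open Literature.MathematicalPhysics.QuantumFieldTheory.Balaban1983to89.B12RTGaugeInvariance254 (liftTransf)
open Literature.MathematicalPhysics.QuantumFieldTheory.Balaban1983to89.GaugeField (gaugeAct)
open N09TowerOfPerBondChartsOfWindowOpenness (hreg_pos_all_of_forwardLaws_of_openness)
open N09CentralWindowOpenMapping (imageWindow_record_mem_nhds_of_mem_strictCentralWindow)
open N09WindowInteriorAtRecord (hopenCrit_of_hsolν_of_numerics)
open N09B0RiderAtRecord (thm3Member_stage13SepCoPH_atDomAlt_of_numerics_of_εreg_eq)

variable {F : T4Family} {N : ℕ} [NeZero N]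

/-! ## §1  The tower from forward laws and numerics (generic Stage-13 parameter, torus, history) -/

/-- The STRICT `2ε_reg∕L²` chart guard of the parametric-openness file follows from the threshold ordering `hord` (`0 ≤ ε₂₉`) and the STRICT `ε₀`-margin.
[cite: Balaban1987RG1, Thm 3 p.264 and (0.19) p.255 (bookkeeping)] -/
theorem margin_two_εreg_lt_of_hord (θ₀ : Stage13Params F N) (K : ℕ) (hε29 : 0 ≤ θ₀.ε₂₉)
    (hord : 2 * θ₀.ν.εreg / ((F.P K).L : ℝ) ^ 2 +
      4 * max θ₀.ε₂₉ (10 * (((((F.P K).d + 2) * (F.P K).L : ℕ) : ℝ) * θ₀.ε₂₉) * ((F.P K).L : ℝ) ^ ((F.P K).d - 1)) ≤ θ₀.ν.ε₀)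
    {α : ℝ} (hα : ((((F.P K).d + 2) * (F.P K).L : ℕ) : ℝ) ^ 2 / 4 * θ₀.ν.ε₀ < α) :
    ((((F.P K).d + 2) * (F.P K).L : ℕ) : ℝ) ^ 2 / 4 * (2 * θ₀.ν.εreg / ((F.P K).L : ℝ) ^ 2) < α := by
  have h4 : 0 ≤ 4 * max θ₀.ε₂₉ (10 * (((((F.P K).d + 2) * (F.P K).L : ℕ) : ℝ) * θ₀.ε₂₉) * ((F.P K).L : ℝ) ^ ((F.P K).d - 1)) :=
    mul_nonneg (by norm_num) (hε29.trans (le_max_left _ _))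
  have hδε : 2 * θ₀.ν.εreg / ((F.P K).L : ℝ) ^ 2 ≤ θ₀.ν.ε₀ := by linarith
  exact lt_of_le_of_lt (mul_le_mul_of_nonneg_left hδε (by positivity)) hα

/-- ★★★ **ROAD A′ RUNS THE (F1) REGULARITY TOWER FROM FORWARD JACOBIAN LAWS AND NUMERICS.**  At a Stage-13 parameter `θ₀`, torus `K`, history `g`, radius `α`
(`0 ≤ α ≤ 1∕24`, `α < δ_N`, `157·α < L^{−(d−1)}`, `offCard c∕|Idx| + 150·α < 1`, STRICT margin `(((d+2)L)²∕4)·ε₀ < α`): IF for every `j < K`, coarse bond `c` and environment `U`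
the FORWARD change-of-variables law of one-bond Haar measure under the one-variable (0.4) average holds on the central `α`-window with a density `jac_j c U ·` that is jointly
measurable, UNIFORMLY bounded below on the window graph and continuous on each window, and given [B11]-existence `hsolν`, N07's `hcrit`, (H-U) `hU`, (I19) `hint` and numerics —
THEN for every `j < K`, `domAlt_{j+1} ⊆ regSetOfRecord K j ρ_j` (N09's `hreg_j`) and `T_jρ_j > 0` on `domAlt_{j+1}` ((F3)_j).  FILE 2 §2 with (O-int) := dag-n09-w6 g4's
`imageWindow_record_mem_nhds_of_mem_strictCentralWindow` and (O) := dag-n09-w6 g4's `hopenCrit_of_hsolν_of_numerics` (over dag-n09-w1 g6's parametric openness) supplied BY NAME.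
CONDITIONAL; nothing of Bałaban's asserted; `hreg` NOT discharged.
[cite: Balaban1987RG1, p.259, (0.4) p.253, (0.19) p.255, (2.3)–(2.4) pp.265–266 and (2.9)–(2.10) pp.266–267; Balaban1985Averaging, (19) p.21, Prop. 2 (53) p.26 and Prop. 3 (124) p.36; Balaban1985Variational, Thm 1 (8)–(10) p.279] -/
theorem hreg_pos_all_of_forwardLaws_of_hsolν_of_numerics (θ₀ : Stage13Params F N) (K : ℕ) (g : ℕ → ℝ) {α : ℝ} (hα0 : 0 ≤ α) (hα24 : α ≤ 1 / 24)
    (hαδ : α < deltaSU (Fin N)) (hαL : 157 * α < ((((F.P K).L : ℝ)) ^ ((F.P K).d - 1))⁻¹)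
    (hgap : ∀ j < K, ∀ c : PBond (F.P K) (j + 1), (offCard c : ℝ) / (Fintype.card (Idx (F.P K)) : ℝ) + 150 * α < 1)
    (jac : ∀ j, PBond (F.P K) (j + 1) → GaugeField (F.P K) j (SU N) → SU N → ℝ≥0)
    (hjacm : ∀ j < K, ∀ c, Measurable fun p : GaugeField (F.P K) j (SU N) × SU N => jac j c p.1 p.2)
    (hjaclb : ∀ j < K, ∀ c : PBond (F.P K) (j + 1), ∃ m : ℝ≥0, 0 < m ∧
      ∀ U g, (∀ i : Idx (F.P K), dist1 (fibreFamily U c (pre U c * g * post U c) i) ≤ α) → m ≤ jac j c U g)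
    (hjacc : ∀ j < K, ∀ c U, ContinuousOn (jac j c U) {g : SU N | ∀ i : Idx (F.P K), dist1 (fibreFamily U c (pre U c * g * post U c) i) ≤ α})
    (hfwd : ∀ j < K, ∀ c U, (HaarData.haar : Measure (SU N)).restrict
        ((fun g => (avOfRecord F N K j).avg (update U (centralBond c) g) c) ''
          {g : SU N | ∀ i : Idx (F.P K), dist1 (fibreFamily U c (pre U c * g * post U c) i) ≤ α}) =
      (((HaarData.haar : Measure (SU N)).restrict {g : SU N | ∀ i : Idx (F.P K), dist1 (fibreFamily U c (pre U c * g * post U c) i) ≤ α}).withDensity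
          fun g => (jac j c U g : ℝ≥0∞)).map (fun g => (avOfRecord F N K j).avg (update U (centralBond c) g) c))
    (hεreg : 0 < θ₀.ν.εreg)
    (hε3 : (143 * (((((F.P K).d + 4 : ℕ) : ℝ)) ^ 2 / 4) ^ 2) * θ₀.ν.εreg ≤ 1 / 3)
    (hε2 : 2 * θ₀.ν.εreg ≤ 2 * deltaSU (Fin N) / ((((F.P K).d + 4) * (F.P K).L : ℕ) : ℝ) ^ 2) (hε29 : 0 < θ₀.ε₂₉)
    (hn1 : 1640 * (2 * (((((F.P K).d + 2) * (F.P K).L : ℕ) : ℝ) * θ₀.ε₂₉) +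
        ((((F.P K).d + 2) * (F.P K).L : ℕ) : ℝ) ^ 2 / 4 * (2 * θ₀.ν.εreg / ((F.P K).L : ℝ) ^ 2)) * (((F.P K).L : ℝ) ^ ((F.P K).d - 1)) ^ 2 ≤ 1)
    (hn2 : 13 * (2 * (((((F.P K).d + 2) * (F.P K).L : ℕ) : ℝ) * θ₀.ε₂₉) +
        ((((F.P K).d + 2) * (F.P K).L : ℕ) : ℝ) ^ 2 / 4 * (2 * θ₀.ν.εreg / ((F.P K).L : ℝ) ^ 2)) * ((F.P K).L : ℝ) ^ ((F.P K).d - 1) < deltaSU (Fin N))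
    (hord : 2 * θ₀.ν.εreg / ((F.P K).L : ℝ) ^ 2 +
      4 * max θ₀.ε₂₉ (10 * (((((F.P K).d + 2) * (F.P K).L : ℕ) : ℝ) * θ₀.ε₂₉) * ((F.P K).L : ℝ) ^ ((F.P K).d - 1)) ≤ θ₀.ν.ε₀)
    (hα : ((((F.P K).d + 2) * (F.P K).L : ℕ) : ℝ) ^ 2 / 4 * θ₀.ν.ε₀ < α)
    (hε₀ : 0 ≤ θ₀.ν.ε₀) (hnumF : ((((F.P K).d * (F.P K).L : ℕ) : ℝ)) ^ 2 / 4 * θ₀.ν.ε₀ < deltaFed (Fin N))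
    (hsolν : ∀ j < K, ∀ W ∈ domAltOfRecord F N θ₀.ν K (j + 1), UkExists F N K (j + 1) θ₀.ν.εreg W)
    (hU : ∀ k, Measurable (Uk F N K (k + 1) θ₀.ν.εreg))
    (hint : ∀ j < K, Integrable (betaInputOfRecord F N (TcanOfRecord F N) (chiFixed29 F N θ₀.ν θ₀.ε₂₉) K g j) (fieldMeasure (F.P K) j (SU N)))
    (hcrit : ∀ j < K, ContinuousOn (critCfgOfRecord F N θ₀.ν K j) (domAltOfRecord F N θ₀.ν K (j + 1))) :
    ∀ j < K, domAltOfRecord F N θ₀.ν K (j + 1) ⊆ regSetOfRecord F N K j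
        (betaInputOfRecord F N (TcanOfRecord F N) (chiFixed29 F N θ₀.ν θ₀.ε₂₉) K g j) ∧
      ∀ V ∈ domAltOfRecord F N θ₀.ν K (j + 1),
        0 < TcanOfRecord F N K j (betaInputOfRecord F N (TcanOfRecord F N) (chiFixed29 F N θ₀.ν θ₀.ε₂₉) K g j) V :=
  hreg_pos_all_of_forwardLaws_of_openness θ₀ K g hα0 hα24 hαδ hgap jac hjacm hjaclb hjacc hfwd
    (fun _ hj => imageWindow_record_mem_nhds_of_mem_strictCentralWindow hj hα24 hαδ hαL)
    (fun j hj => hopenCrit_of_hsolν_of_numerics θ₀.ν hj hα24 hαδ hαL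
      (fun c U => (fun g => (avOfRecord F N K j).avg (update U (centralBond c) g) c) ''
        {g : SU N | ∀ i : Idx (F.P K), dist1 (fibreFamily U c (pre U c * g * post U c) i) ≤ α}) (fun _ _ => rfl)
      hεreg hε3 hε2 (margin_two_εreg_lt_of_hord θ₀ K hε29.le hord hα) hsolν)
    hεreg hε3 hε2 hε29 hn1 hn2 hord hα hε₀ hnumF hsolν hU hint hcrit


/-! ## §2  At the Stage-13 record: N09's analytic inclusion `hreg` and dag-n09-w4 g3's Theorem-3 door, from forward laws and numerics -/

section Record

variable (θ : Stage13HParams F N) (h : θ.Provisos₁₃SepCoPH F N) {w : WorldP} (P : B12.RunParams)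

/-- ★★ **THE DOORS' ANALYTIC INCLUSION `hreg` AT THE STAGE-13 RECORD FROM FORWARD LAWS AND NUMERICS** (`TβOfRecord₁₃ = TcanOfRecord`, `chiβOfRecord₁₃ θ = chiFixed29 θ.ν θ.ε₂₉`, `rfl`):
§1 at `θ.toStage13Params`, `P.K`, `gOfRecord₁₃ θ P`. CONDITIONAL on the displayed forward-law package, numerics, `hsolν hcrit hU hint`; nothing of Bałaban's asserted.
[cite: Balaban1987RG1, p.259, (2.10) p.267 and (0.13) p.254] -/
theorem hreg_of_forwardLaws_of_hsolν_of_numerics {α : ℝ} (hα0 : 0 ≤ α) (hα24 : α ≤ 1 / 24)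
    (hαδ : α < deltaSU (Fin N)) (hαL : 157 * α < ((((F.P P.K).L : ℝ)) ^ ((F.P P.K).d - 1))⁻¹)
    (hgap : ∀ j < P.K, ∀ c : PBond (F.P P.K) (j + 1), (offCard c : ℝ) / (Fintype.card (Idx (F.P P.K)) : ℝ) + 150 * α < 1)
    (jac : ∀ j, PBond (F.P P.K) (j + 1) → GaugeField (F.P P.K) j (SU N) → SU N → ℝ≥0)
    (hjacm : ∀ j < P.K, ∀ c, Measurable fun p : GaugeField (F.P P.K) j (SU N) × SU N => jac j c p.1 p.2)
    (hjaclb : ∀ j < P.K, ∀ c : PBond (F.P P.K) (j + 1), ∃ m : ℝ≥0, 0 < m ∧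
      ∀ U g, (∀ i : Idx (F.P P.K), dist1 (fibreFamily U c (pre U c * g * post U c) i) ≤ α) → m ≤ jac j c U g)
    (hjacc : ∀ j < P.K, ∀ c U, ContinuousOn (jac j c U) {g : SU N | ∀ i : Idx (F.P P.K), dist1 (fibreFamily U c (pre U c * g * post U c) i) ≤ α})
    (hfwd : ∀ j < P.K, ∀ c U, (HaarData.haar : Measure (SU N)).restrict
        ((fun g => (avOfRecord F N P.K j).avg (update U (centralBond c) g) c) ''
          {g : SU N | ∀ i : Idx (F.P P.K), dist1 (fibreFamily U c (pre U c * g * post U c) i) ≤ α}) =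
      (((HaarData.haar : Measure (SU N)).restrict {g : SU N | ∀ i : Idx (F.P P.K), dist1 (fibreFamily U c (pre U c * g * post U c) i) ≤ α}).withDensity
          fun g => (jac j c U g : ℝ≥0∞)).map (fun g => (avOfRecord F N P.K j).avg (update U (centralBond c) g) c))
    (hεreg : 0 < θ.toStage13Params.ν.εreg)
    (hε3 : (143 * (((((F.P P.K).d + 4 : ℕ) : ℝ)) ^ 2 / 4) ^ 2) * θ.toStage13Params.ν.εreg ≤ 1 / 3)
    (hε2 : 2 * θ.toStage13Params.ν.εreg ≤ 2 * deltaSU (Fin N) / ((((F.P P.K).d + 4) * (F.P P.K).L : ℕ) : ℝ) ^ 2) (hε29 : 0 < θ.toStage13Params.ε₂₉)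
    (hn1 : 1640 * (2 * (((((F.P P.K).d + 2) * (F.P P.K).L : ℕ) : ℝ) * θ.toStage13Params.ε₂₉) +
        ((((F.P P.K).d + 2) * (F.P P.K).L : ℕ) : ℝ) ^ 2 / 4 * (2 * θ.toStage13Params.ν.εreg / ((F.P P.K).L : ℝ) ^ 2)) * (((F.P P.K).L : ℝ) ^ ((F.P P.K).d - 1)) ^ 2 ≤ 1)
    (hn2 : 13 * (2 * (((((F.P P.K).d + 2) * (F.P P.K).L : ℕ) : ℝ) * θ.toStage13Params.ε₂₉) +
        ((((F.P P.K).d + 2) * (F.P P.K).L : ℕ) : ℝ) ^ 2 / 4 * (2 * θ.toStage13Params.ν.εreg / ((F.P P.K).L : ℝ) ^ 2)) * ((F.P P.K).L : ℝ) ^ ((F.P P.K).d - 1) < deltaSU (Fin N))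
    (hord : 2 * θ.toStage13Params.ν.εreg / ((F.P P.K).L : ℝ) ^ 2 +
      4 * max θ.toStage13Params.ε₂₉ (10 * (((((F.P P.K).d + 2) * (F.P P.K).L : ℕ) : ℝ) * θ.toStage13Params.ε₂₉) * ((F.P P.K).L : ℝ) ^ ((F.P P.K).d - 1)) ≤
        θ.toStage13Params.ν.ε₀)
    (hα : ((((F.P P.K).d + 2) * (F.P P.K).L : ℕ) : ℝ) ^ 2 / 4 * θ.toStage13Params.ν.ε₀ < α)
    (hε₀ : 0 ≤ θ.toStage13Params.ν.ε₀) (hnumF : ((((F.P P.K).d * (F.P P.K).L : ℕ) : ℝ)) ^ 2 / 4 * θ.toStage13Params.ν.ε₀ < deltaFed (Fin N))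
    (hsolν : ∀ j < P.K, ∀ W ∈ domAltOfRecord F N θ.ν P.K (j + 1), UkExists F N P.K (j + 1) θ.toStage13Params.ν.εreg W)
    (hU : ∀ k, Measurable (Uk F N P.K (k + 1) θ.toStage13Params.ν.εreg))
    (hint : ∀ j < P.K, Integrable (betaInputOfRecord F N (TβOfRecord₁₃ F N) (chiβOfRecord₁₃ F N θ.toStage13Params) P.K (gOfRecord₁₃ F N θ.toStage13Params P) j)
      (fieldMeasure (F.P P.K) j (SU N)))
    (hcrit : ∀ j < P.K, ContinuousOn (critCfgOfRecord F N θ.toStage13Params.ν P.K j) (domAltOfRecord F N θ.ν P.K (j + 1))) :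
    ∀ j < P.K, domAltOfRecord F N θ.ν P.K (j + 1) ⊆ regSetOfRecord F N P.K j
      (betaInputOfRecord F N (TβOfRecord₁₃ F N) (chiβOfRecord₁₃ F N θ.toStage13Params) P.K (gOfRecord₁₃ F N θ.toStage13Params P) j) :=
  fun j hj => (hreg_pos_all_of_forwardLaws_of_hsolν_of_numerics θ.toStage13Params P.K (gOfRecord₁₃ F N θ.toStage13Params P) hα0 hα24 hαδ hαL hgap
    jac hjacm hjaclb hjacc hfwd hεreg hε3 hε2 hε29 hn1 hn2 hord hα hε₀ hnumF hsolν hU hint hcrit j hj).1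

/-- ★★★ **N09's THEOREM-3 MEMBER AT THE STAGE-13 RECORD FROM FORWARD JACOBIAN LAWS AND NUMERICS** (dag-n09-w4 g3's door
`…N09B0RiderAtRecord.thm3Member_stage13SepCoPH_atDomAlt_of_numerics_of_εreg_eq` with `hreg := hreg_of_forwardLaws_of_hsolν_of_numerics …`): N09-side inputs = the FORWARD-LAW
package of the one-variable (0.4) averages on the central `α`-windows (`jac hjacm hjaclb hjacc hfwd` — dag-n09-w4 g5's 6d₃ by name, plus a uniform lower bound), window ∕ margin
numerics, (181)ˢᵒˡ `hcov`, [B11] ×3 at `εbg` (`h11 hres huniq`), `hsolν`, N07's `hcrit`, (H-U) `hU`, (I19) `hint`, numerics — NO `hreg`, NO chart, NO socket, NO per-bond inversion data.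
CONDITIONAL; nothing of Bałaban's asserted; N09 NOT discharged. [cite: Balaban1987RG1, Thm 3 p.264, p.259, (0.4) p.253, (0.17)–(0.19) p.255, (2.9)–(2.10) pp.266–267; Balaban1985Variational, Thm 1 (8)–(10) p.279 and (181) p.307; Balaban1985Averaging, Prop. 2 (53) p.26 and Prop. 3 (124) p.36] -/
theorem thm3Member_stage13SepCoPH_atDomAlt_of_forwardLaws_of_numerics_of_εreg_eq
    (hC : w.C = (datumOfRecord₁₃SepCoPH F N θ h).C) (heq : θ.toStage13Params.ν.εreg = θ.εbg) {α : ℝ} (hα0 : 0 ≤ α) (hα24 : α ≤ 1 / 24)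
    (hαδ : α < deltaSU (Fin N)) (hαL : 157 * α < ((((F.P P.K).L : ℝ)) ^ ((F.P P.K).d - 1))⁻¹)
    (hgap : ∀ j < P.K, ∀ c : PBond (F.P P.K) (j + 1), (offCard c : ℝ) / (Fintype.card (Idx (F.P P.K)) : ℝ) + 150 * α < 1)
    (jac : ∀ j, PBond (F.P P.K) (j + 1) → GaugeField (F.P P.K) j (SU N) → SU N → ℝ≥0)
    (hjacm : ∀ j < P.K, ∀ c, Measurable fun p : GaugeField (F.P P.K) j (SU N) × SU N => jac j c p.1 p.2)
    (hjaclb : ∀ j < P.K, ∀ c : PBond (F.P P.K) (j + 1), ∃ m : ℝ≥0, 0 < m ∧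
      ∀ U g, (∀ i : Idx (F.P P.K), dist1 (fibreFamily U c (pre U c * g * post U c) i) ≤ α) → m ≤ jac j c U g)
    (hjacc : ∀ j < P.K, ∀ c U, ContinuousOn (jac j c U) {g : SU N | ∀ i : Idx (F.P P.K), dist1 (fibreFamily U c (pre U c * g * post U c) i) ≤ α})
    (hfwd : ∀ j < P.K, ∀ c U, (HaarData.haar : Measure (SU N)).restrict
        ((fun g => (avOfRecord F N P.K j).avg (update U (centralBond c) g) c) ''
          {g : SU N | ∀ i : Idx (F.P P.K), dist1 (fibreFamily U c (pre U c * g * post U c) i) ≤ α}) =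
      (((HaarData.haar : Measure (SU N)).restrict {g : SU N | ∀ i : Idx (F.P P.K), dist1 (fibreFamily U c (pre U c * g * post U c) i) ≤ α}).withDensity
          fun g => (jac j c U g : ℝ≥0∞)).map (fun g => (avOfRecord F N P.K j).avg (update U (centralBond c) g) c))
    (hεreg : 0 < θ.toStage13Params.ν.εreg)
    (hε3 : (143 * (((((F.P P.K).d + 4 : ℕ) : ℝ)) ^ 2 / 4) ^ 2) * θ.toStage13Params.ν.εreg ≤ 1 / 3)
    (hε2 : 2 * θ.toStage13Params.ν.εreg ≤ 2 * deltaSU (Fin N) / ((((F.P P.K).d + 4) * (F.P P.K).L : ℕ) : ℝ) ^ 2) (hε29 : 0 < θ.toStage13Params.ε₂₉)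
    (hn1 : 1640 * (2 * (((((F.P P.K).d + 2) * (F.P P.K).L : ℕ) : ℝ) * θ.toStage13Params.ε₂₉) +
        ((((F.P P.K).d + 2) * (F.P P.K).L : ℕ) : ℝ) ^ 2 / 4 * (2 * θ.toStage13Params.ν.εreg / ((F.P P.K).L : ℝ) ^ 2)) * (((F.P P.K).L : ℝ) ^ ((F.P P.K).d - 1)) ^ 2 ≤ 1)
    (hn2 : 13 * (2 * (((((F.P P.K).d + 2) * (F.P P.K).L : ℕ) : ℝ) * θ.toStage13Params.ε₂₉) +
        ((((F.P P.K).d + 2) * (F.P P.K).L : ℕ) : ℝ) ^ 2 / 4 * (2 * θ.toStage13Params.ν.εreg / ((F.P P.K).L : ℝ) ^ 2)) * ((F.P P.K).L : ℝ) ^ ((F.P P.K).d - 1) < deltaSU (Fin N))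
    (hord : 2 * θ.toStage13Params.ν.εreg / ((F.P P.K).L : ℝ) ^ 2 +
      4 * max θ.toStage13Params.ε₂₉ (10 * (((((F.P P.K).d + 2) * (F.P P.K).L : ℕ) : ℝ) * θ.toStage13Params.ε₂₉) * ((F.P P.K).L : ℝ) ^ ((F.P P.K).d - 1)) ≤
        θ.toStage13Params.ν.ε₀)
    (hα : ((((F.P P.K).d + 2) * (F.P P.K).L : ℕ) : ℝ) ^ 2 / 4 * θ.toStage13Params.ν.ε₀ < α)
    (hε₀ : 0 ≤ θ.toStage13Params.ν.ε₀) (hnumF : ((((F.P P.K).d * (F.P P.K).L : ℕ) : ℝ)) ^ 2 / 4 * θ.toStage13Params.ν.ε₀ < deltaFed (Fin N))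
    (hcov : ∀ j < P.K, ∀ (v : GaugeTransf (F.P P.K) (j + 1) (SU N)) (W : GaugeField (F.P P.K) (j + 1) (SU N)),
      UkExists F N P.K (j + 1) θ.toStage13Params.ν.εreg W →
        critCfgOfRecord F N θ.toStage13Params.ν P.K j (gaugeAct v W) = gaugeAct (liftTransf v) (critCfgOfRecord F N θ.toStage13Params.ν P.K j W))
    (hsolν : ∀ j < P.K, ∀ W ∈ domAltOfRecord F N θ.ν P.K (j + 1), UkExists F N P.K (j + 1) θ.toStage13Params.ν.εreg W)
    (hU : ∀ k, Measurable (Uk F N P.K (k + 1) θ.toStage13Params.ν.εreg))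
    (hint : ∀ j < P.K, Integrable (betaInputOfRecord F N (TβOfRecord₁₃ F N) (chiβOfRecord₁₃ F N θ.toStage13Params) P.K (gOfRecord₁₃ F N θ.toStage13Params P) j)
      (fieldMeasure (F.P P.K) j (SU N)))
    (hcrit : ∀ j < P.K, ContinuousOn (critCfgOfRecord F N θ.toStage13Params.ν P.K j) (domAltOfRecord F N θ.ν P.K (j + 1)))
    (h11 : ∀ k, k ≤ P.K → ∀ V ∈ domAltOfRecord F N θ.ν P.K k, UkExists F N P.K k θ.εbg V ∧ UniqueUkOrbit F N P.K k θ.εbg V)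
    (hres : ∀ k, k ≤ P.K → HRestrict F N θ.εbg P.K k (domAltOfRecord F N θ.ν P.K k))
    (huniq : ∀ k, k ≤ P.K → ∀ V ∈ domAltOfRecord F N θ.ν P.K k, ∀ j < k,
      UniqueUkOrbit F N P.K (j + 1) θ.εbg (Averaging.iter (avOfRecord F N P.K) (j + 1) (Uk F N P.K k θ.εbg V))) :
    (leavesP w P).smallCouplings → (leavesP w P).smallFieldInductive :=
  thm3Member_stage13SepCoPH_atDomAlt_of_numerics_of_εreg_eq θ h hC P hε29 heq hεreg hε3 hε2 hord hn1 hn2 hcov hsolν hint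
    (hreg_of_forwardLaws_of_hsolν_of_numerics θ P hα0 hα24 hαδ hαL hgap jac hjacm hjaclb hjacc hfwd hεreg hε3 hε2 hε29 hn1 hn2 hord hα hε₀ hnumF hsolν hU hint hcrit)
    h11 hres huniq

end Record


end Summit.QuantumFields.YangMills.BalabanUVNodes.N09TowerOfForwardLawsOfNumerics

end
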